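import Mathlib
import Summits.KontsevichZagierPeriods.KontsevichZagierPeriods.Theorems.SoloInformedFormalPeriodRing
import Literature.NumberTheory.Transcendental.OneMotiveToricProofs
import HarnessLib
import HarnessLib.Audit

/-!
# SoloInformed — Proposition VI (KERNEL): the Period Conjecture for the localised category does
# not imply the Period Conjecture, fullness, or injectivity for the effective category

This is the kernel form of Proposition VI of the SoloInformed paper (§6quinquies; formerly PAPER,
CLAIMS C130), built on `SoloInformedFormalPeriodModel` / `SoloInformedFormalPeriodRing`, where the
space of formal periods of [HW22, Def. 7.6] of the tensor category `𝒞_G` of `G`-graded finite sets is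
computed VERBATIM from the definition (`P̃(𝒞_G) = ℚ[G]`, product = `⊗`, `ev p_g = c^{w g}`).

The model.  The effective index monoid is `E = {0, u, χ, χ², …}` (`SoloInformedEffIdx`: `u + u = u`,
`u + χⁿ = χⁿ`, `χⁿ + χᵐ = χⁿ⁺ᵐ`) — the monoid of indecomposables of `Rep_ℚ((𝔸¹, ×) ⊔ {z})` of the
paper — with weight `wt : E →+ ℤ` (`u ↦ 0`, `χⁿ ↦ n`).  `C^eff := 𝒞_E` with atoms `𝟙 = 𝟙_0`,
`U = 𝟙_u`, `𝕃 = 𝟙_χ`; `C := 𝒞_ℤ` (`ℤ`-graded finite sets = the skeleton of `Rep_ℚ(𝔾_m)`), and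
`F := wt_* : C^eff → C` is the change-of-degrees tensor functor (it inverts `𝕃`: `F𝕃 = 𝟙_1`,
`p_1` a unit).  Fibre functors: `V(X) = (ℚ^{X.B}, ℚ^{X.B}, diag(c^{wt(deg b)}))`, compatible with `F`
(`SoloInformedGrObj.mapObj_comparison`, `ev_fpMap`).

Results (all KERNEL, hypothesis-free):
* `pc_localised_iff` — the Period Conjecture [HW22, Def. 7.15] for `(C, c)` holds IFF `c` is
  transcendental; `pc_localised_twoPiI` — it HOLDS for `c = 2πi` (Lindemann, from the tree's
  sorry-free Lindemann–Weierstrass `Literature.NumberTheory.Transcendental.transcendental_two_pi_I`);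
* `per_mul_phantom`, `phantom_ne_zero`, `per_ne_zero` — `per := p_χ = ⟦(𝕃, e, e^∨)⟧` is a ZERO
  DIVISOR of `P̃(C^eff)`: `per · (p_𝟙 − p_U) = 0`;
* `ev_phantom`, `not_pc_effective` — `ev(p_𝟙 − p_U) = 0` for EVERY comparison constant `c`, so the
  Period Conjecture FAILS for `C^eff` whatever the fibre functor of this shape;
* `fpMap_phantom`, `isUnit_fpMap_per`, `not_injective_fpMap`, `ker_fpMap` —
  `P̃(F) : P̃(C^eff) → P̃(C)` kills exactly the line `ℚ · (p_𝟙 − p_U)` and inverts `per`;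
* `F_faithful`, `hom_unit_U`, `F_not_full` — `F` is faithful and NOT full
  (`Hom_{C^eff}(𝟙, U) = 0`, `Hom_C(F𝟙, FU) = ℚ`);
* `soloInformed_propositionVI` — the conjunction.
Hence none of "PC(C) ⇒ PC(C^eff)", "PC(C) ⇒ F full", "PC(C) ⇒ P̃(C^eff) → P̃(C) injective" is a
theorem of the abstract period formalism of [HW22, Ch. 7] = [Hub20, §§3–5]: in the dictionary of the
paper (Prop. V), GPC ⇏ FULL^eff / EFF-INJ formally, i.e. the residual conjunct `KZ.PiCancellation` of
`KZP ⟺ GPC ∧ KZ.PiCancellation` cannot be derived from the Period Conjecture for the localised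
category by an argument that sees only `(P̃, ev, localisation)`.

References: A. Huber, G. Wüstholz, *Transcendence and linear relations of 1-periods*, Cambridge
Tracts in Math. 227 (2022), Def. 7.6, 7.11, 7.15, Prop. 7.17, Cor. 7.19, p. 200, App. A.3;
A. Huber, *Galois theory of periods*, Münster J. Math. 13 (2020), §§3–5; F. Lindemann, *Über die
Zahl π*, Math. Ann. 20 (1882).
-/

noncomputable section

open scoped BigOperators

namespace Summit.KontsevichZagierPeriods.KontsevichZagierPeriods.Theorems

/-- The effective index monoid `E = {0, u, χ¹, χ², …}`; `chi n` stands for `χⁿ⁺¹`. -/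
inductive SoloInformedEffIdx : Type
  | zero
  | idem
  | chi (n : ℕ)
  deriving DecidableEq

namespace SoloInformedEffIdx

/-- The monoid law: `0` neutral, `u + u = u`, `u + χⁿ = χⁿ`, `χⁿ + χᵐ = χⁿ⁺ᵐ`. -/
def add : SoloInformedEffIdx → SoloInformedEffIdx → SoloInformedEffIdx
  | zero, zero => zero
  | zero, idem => idem
  | zero, chi n => chi n
  | idem, zero => idem
  | idem, idem => idem
  | idem, chi n => chi n
  | chi n, zero => chi n
  | chi n, idem => chi n
  | chi n, chi m => chi (n + m + 1)

/-- The neutral element `0`. -/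
instance instZero : Zero SoloInformedEffIdx := ⟨zero⟩

/-- The addition. -/
instance instAdd : Add SoloInformedEffIdx := ⟨add⟩

/-- `E` is a commutative monoid. -/
instance instAddCommMonoid : AddCommMonoid SoloInformedEffIdx where
  add := (· + ·)
  zero := 0
  add_assoc := by
    rintro (_ | _ | a) (_ | _ | b) (_ | _ | c) <;> first | rfl | exact congrArg chi (by omega)
  zero_add := by rintro (_ | _ | a) <;> rfl
  add_zero := by rintro (_ | _ | a) <;> rfl
  add_comm := by rintro (_ | _ | a) (_ | _ | b) <;> first | rfl | exact congrArg chi (by omega)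
  nsmul := nsmulRec

/-- The constructor `zero` is the neutral element. -/
theorem zero_def : (zero : SoloInformedEffIdx) = 0 := rfl

/-- `u + u = u`. -/
@[simp] theorem idem_add_idem : (idem + idem : SoloInformedEffIdx) = idem := rfl

/-- `u + χⁿ = χⁿ`. -/
@[simp] theorem idem_add_chi (n : ℕ) : (idem + chi n : SoloInformedEffIdx) = chi n := rfl

/-- `χⁿ + u = χⁿ`. -/
@[simp] theorem chi_add_idem (n : ℕ) : (chi n + idem : SoloInformedEffIdx) = chi n := rfl

/-- `χⁿ⁺¹ + χᵐ⁺¹ = χⁿ⁺ᵐ⁺²`. -/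
@[simp] theorem chi_add_chi (n m : ℕ) : (chi n + chi m : SoloInformedEffIdx) = chi (n + m + 1) :=
  rfl

/-- `u ≠ 0`. -/
@[simp] theorem idem_ne_zero : (idem : SoloInformedEffIdx) ≠ 0 := fun h => by cases h

/-- `0 ≠ u`. -/
@[simp] theorem zero_ne_idem : (0 : SoloInformedEffIdx) ≠ idem := fun h => by cases h

/-- `χⁿ ≠ 0`. -/
@[simp] theorem chi_ne_zero (n : ℕ) : (chi n : SoloInformedEffIdx) ≠ 0 := fun h => by cases h

/-- The exponent of `χ` (`0` on `0` and `u`). -/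
def expo : SoloInformedEffIdx → ℕ
  | zero => 0
  | idem => 0
  | chi n => n + 1

/-- `expo` is additive. -/
theorem expo_add : ∀ x y : SoloInformedEffIdx, expo (x + y) = expo x + expo y := by
  rintro (_ | _ | a) (_ | _ | b) <;> first | rfl | (show expo (chi _) = _; simp only [expo]; omega)

/-- The weight `wt : E →+ ℤ` (`0, u ↦ 0`, `χⁿ ↦ n`): the localisation `E → E[−χ] = ℤ`. -/
def wt : SoloInformedEffIdx →+ ℤ where
  toFun x := (expo x : ℤ)
  map_zero' := by show ((expo zero : ℕ) : ℤ) = 0; simp [expo]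
  map_add' x y := by simp [expo_add]

/-- `wt u = 0`. -/
@[simp] theorem wt_idem : wt idem = 0 := by show ((expo idem : ℕ) : ℤ) = 0; simp [expo]

/-- `wt χⁿ⁺¹ = n + 1`. -/
@[simp] theorem wt_chi (n : ℕ) : wt (chi n) = n + 1 := by
  show ((expo (chi n) : ℕ) : ℤ) = _; simp [expo]

end SoloInformedEffIdx

/-! ### The model -/

namespace SoloInformedEffModel

open SoloInformedGrObj SoloInformedEffIdx AddMonoidAlgebra

/-- Notation: `E` = the effective index monoid. -/
abbrev E : Type := SoloInformedEffIdx

/-- The unit object `𝟙` of `C^eff = 𝒞_E`. -/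
@[reducible] def unitObj : SoloInformedGrObj E := line (0 : E)

/-- The object `U` (`U ⊗ U ≅ U`, `Hom(𝟙, U) = 0`). -/
@[reducible] def uObj : SoloInformedGrObj E := line idem

/-- The object `𝕃 = χ` at which one localises. -/
@[reducible] def lefObj : SoloInformedGrObj E := line (chi 0)

/-- `per := ⟦(𝕃, e, e^∨)⟧ = p_χ`, the formal period of `𝕃`. -/
def per : FP E := gen (chi 0)

/-- The phantom class `x := p_𝟙 − p_U`. -/
def phantom : FP E := gen (0 : E) - gen idem

/-- `per` is the class of the symbol `(𝕃, e, e^∨)`. -/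
theorem per_eq_cls : per = cls lefObj (fun _ => 1) (fun _ => 1) := rfl

/-- `x` is the difference of the symbols `(𝟙, e, e^∨)` and `(U, e, e^∨)`. -/
theorem phantom_eq_cls :
    phantom = cls unitObj (fun _ => 1) (fun _ => 1) - cls uObj (fun _ => 1) (fun _ => 1) := rfl

/-- `x ≠ 0` in `P̃(C^eff)`. -/
theorem phantom_ne_zero : phantom ≠ 0 := fun h =>
  zero_ne_idem (gen_injective (sub_eq_zero.1 h))

/-- `per ≠ 0`. -/
theorem per_ne_zero : per ≠ 0 := gen_ne_zero _

/-- THE ZERO DIVISOR: `per · x = p_{χ+0} − p_{χ+u} = 0`. -/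
theorem per_mul_phantom : per * phantom = 0 := by
  rw [per, phantom, mul_sub, ← gen_add, ← gen_add, add_zero, chi_add_idem, sub_self]

/-- `per` is a zero divisor of the ring `P̃(C^eff)`. -/
theorem per_zero_divisor : ∃ x : FP E, x ≠ 0 ∧ per * x = 0 :=
  ⟨phantom, phantom_ne_zero, per_mul_phantom⟩

/-- `per ∉ (P̃(C^eff))⁰`. -/
theorem per_not_mem_nonZeroDivisors : per ∉ nonZeroDivisors (FP E) := fun h =>
  phantom_ne_zero ((mem_nonZeroDivisors_iff_right.1 h) phantom
    (by rw [mul_comm]; exact per_mul_phantom))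

/-! ### The Period Conjecture fails for `C^eff` -/

/-- `ev(x) = c⁰ − c⁰ = 0` for every comparison constant `c`. -/
theorem ev_phantom (c : ℂˣ) : evRingHom wt c phantom = 0 := by
  rw [phantom, map_sub, ev_gen, ev_gen, map_zero, wt_idem, sub_self]

/-- The Period Conjecture [HW22, Def. 7.15] FAILS for `(C^eff, wt, c)`, for every `c ∈ ℂˣ`. -/
theorem not_pc_effective (c : ℂˣ) : ¬ Function.Injective (evRingHom (G := E) wt c) := fun h =>
  phantom_ne_zero (h (by rw [ev_phantom, map_zero]))

/-! ### The localisation functor `F = wt_* : C^eff → C = 𝒞_ℤ` on formal periods -/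

/-- `P̃(F)(x) = p_0 − p_0 = 0`. -/
theorem fpMap_phantom : fpMap wt phantom = 0 := by
  rw [phantom, map_sub, fpMap_gen, fpMap_gen, map_zero, wt_idem, sub_self]

/-- `P̃(F) : P̃(C^eff) → P̃(C)` is NOT injective. -/
theorem not_injective_fpMap : ¬ Function.Injective (fpMap (G := E) wt) := fun h =>
  phantom_ne_zero (h (by rw [fpMap_phantom, map_zero]))

/-- `P̃(F)(per) = p_1`. -/
theorem fpMap_per : fpMap wt per = gen (1 : ℤ) := by
  rw [per, fpMap_gen, wt_chi, Nat.cast_zero, zero_add]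

/-- `per` becomes a unit in `P̃(C)` (`p_1 p_{-1} = p_0 = 1`). -/
theorem isUnit_fpMap_per : IsUnit (fpMap wt per) := by
  rw [fpMap_per]
  refine isUnit_iff_exists_inv.2 ⟨gen (-1 : ℤ), ?_⟩
  rw [← gen_add, add_neg_cancel, gen_zero_eq_one]

/-- The section `ℤ → E` of `wt` on `wt(E) = ℕ`, extended by `u`: `n ≥ 1 ↦ χⁿ`, `n ≤ 0 ↦ u`. -/
def ofInt : ℤ → E
  | Int.ofNat 0 => idem
  | Int.ofNat (n + 1) => chi n
  | Int.negSucc _ => idem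

/-- `ofInt (wt g) = g + u`. -/
theorem ofInt_wt (g : E) : ofInt (wt g) = g + idem := by
  cases g <;> rfl

/-- The `ℚ`-linear retraction `P̃(C) → P̃(C^eff)`, `p_n ↦ p_{ofInt n}`. -/
def retr : FP ℤ →ₗ[ℚ] FP E :=
  Finsupp.linearCombination ℚ (fun n : ℤ => gen (ofInt n)) ∘ₗ
    (AddMonoidAlgebra.coeffLinearEquiv ℚ).toLinearMap ∘ₗ (fpEquiv (G := ℤ)).toLinearMap

/-- `retr p_n = p_{ofInt n}`. -/
@[simp] theorem retr_gen (n : ℤ) : retr (gen n) = gen (ofInt n) := by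
  simp only [retr, LinearMap.comp_apply, LinearEquiv.coe_toLinearMap, fpEquiv_gen,
    AddMonoidAlgebra.coeffLinearEquiv_apply, AddMonoidAlgebra.coeff_single,
    Finsupp.linearCombination_single, one_smul]

/-- `retr ∘ P̃(F)` is multiplication by `p_U`. -/
theorem retr_fpMap (y : FP E) : retr (fpMap wt y) = y * gen idem := by
  have key : retr ∘ₗ (fpMap (G := E) wt).toAddMonoidHom.toRatLinearMap =
      LinearMap.mulRight ℚ (gen idem : FP E) :=
    linearMap_ext fun g => by simp [ofInt_wt, gen_add]
  exact LinearMap.congr_fun key y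

/-- Multiplication by the phantom class is the projection `y ↦ (coefficient of p_𝟙 in y) · x`. -/
theorem mul_phantom (y : FP E) : y * phantom = (fpEquiv y).coeff 0 • phantom := by
  have key : LinearMap.mulRight ℚ phantom =
      (LinearMap.toSpanSingleton ℚ (FP E) phantom) ∘ₗ Finsupp.lapply (0 : E) ∘ₗ
        (AddMonoidAlgebra.coeffLinearEquiv ℚ).toLinearMap ∘ₗ (fpEquiv (G := E)).toLinearMap := by
    refine linearMap_ext fun g => ?_
    rcases g with _ | _ | n
    · simp [zero_def, phantom, gen_zero_eq_one]
    · simp [phantom, mul_sub, ← gen_add]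
    · simp [phantom, mul_sub, ← gen_add]
  exact LinearMap.congr_fun key y

/-- THE KERNEL OF `P̃(F)` is the line `ℚ · x` (= the annihilator of `per`):
`P̃(C^eff) ⊋ P̃(C^eff)/ℚx ↪ P̃(C)`. -/
theorem ker_fpMap (y : FP E) : fpMap wt y = 0 ↔ ∃ r : ℚ, y = r • phantom := by
  constructor
  · intro h
    refine ⟨(fpEquiv y).coeff 0, ?_⟩
    have h1 : y * gen idem = 0 := by rw [← retr_fpMap, h, map_zero]
    calc y = y * (gen idem + phantom) := by
            rw [phantom, add_sub_cancel, gen_zero_eq_one, mul_one]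
      _ = y * phantom := by rw [mul_add, h1, zero_add]
      _ = (fpEquiv y).coeff 0 • phantom := mul_phantom y
  · rintro ⟨r, rfl⟩
    rw [map_rat_smul, fpMap_phantom, smul_zero]

/-- `ann(per) = ℚ · x` as well. -/
theorem per_mul_eq_zero_iff (y : FP E) : per * y = 0 ↔ ∃ r : ℚ, y = r • phantom := by
  rw [← ker_fpMap]
  constructor
  · intro h
    have hu := isUnit_fpMap_per
    have : fpMap wt per * fpMap wt y = 0 := by rw [← map_mul, h, map_zero]
    exact (hu.mul_right_eq_zero).1 this
  · intro h
    obtain ⟨r, rfl⟩ := (ker_fpMap y).1 h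
    rw [mul_smul_comm, per_mul_phantom, smul_zero]

/-! ### `F` is faithful and not full -/

/-- `F` is faithful. -/
theorem F_faithful (X Y : SoloInformedGrObj E) :
    Function.Injective (mapHom wt (X := X) (Y := Y)) :=
  mapHom_injective wt X Y

/-- `Hom_{C^eff}(𝟙, U) = 0` (the degrees `0 ≠ u` differ). -/
theorem hom_unit_U (f : Hom unitObj uObj) : f.mat = fun _ _ => 0 := by
  funext y x
  exact f.graded y x (by simp)

/-- … but `Hom_C(F𝟙, FU) ∋` the identity matrix (both of degree `0`). -/
def extraHom : Hom (mapObj wt unitObj) (mapObj wt uObj) where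
  mat := fun _ _ => 1
  graded y x hne := (hne (by simp)).elim

/-- `F` is NOT full: `extraHom` is not in the image of `Hom_{C^eff}(𝟙, U) = 0`. -/
theorem F_not_full : ¬ Function.Surjective (mapHom wt (X := unitObj) (Y := uObj)) := by
  intro h
  obtain ⟨f, hf⟩ := h extraHom
  have h1 := congrArg (fun g => g.mat () ()) hf
  simp only [mapHom_mat, hom_unit_U f, extraHom] at h1
  exact zero_ne_one h1

/-! ### The Period Conjecture holds for `C = 𝒞_ℤ` iff `c` is transcendental -/

/-- The evaluation of `C` on a Laurent monomial: `ev (Tⁿ) = cⁿ`. -/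
theorem evAlg_T (c : ℂˣ) (n : ℤ) :
    evAlg (AddMonoidHom.id ℤ) c (LaurentPolynomial.T n : LaurentPolynomial ℚ) = (c : ℂ) ^ n := by
  show evAlg _ c (AddMonoidAlgebra.single n (1 : ℚ)) = _
  rw [evAlg_single]; simp

/-- The evaluation of `C` on polynomials is polynomial evaluation at `c`. -/
theorem evAlg_toLaurent (c : ℂˣ) (p : Polynomial ℚ) :
    evAlg (AddMonoidHom.id ℤ) c (Polynomial.toLaurent p) = Polynomial.aeval (c : ℂ) p := by
  have key : (evAlg (G := ℤ) (AddMonoidHom.id ℤ) c).comp Polynomial.toLaurentAlg =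
      Polynomial.aeval (c : ℂ) := by
    apply Polynomial.algHom_ext
    rw [AlgHom.comp_apply, Polynomial.toLaurentAlg_apply, Polynomial.toLaurent_X, evAlg_T,
      Polynomial.aeval_X, zpow_one]
  rw [← key, AlgHom.comp_apply, Polynomial.toLaurentAlg_apply]

/-- PC(C) ⟸ transcendence: if `c` is transcendental, `ev : P̃(𝒞_ℤ) = ℚ[t, t⁻¹] → ℂ`, `t ↦ c`, is
injective. -/
theorem pc_localised {c : ℂˣ} (hc : Transcendental ℚ (c : ℂ)) :
    Function.Injective (evRingHom (G := ℤ) (AddMonoidHom.id ℤ) c) := by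
  rw [ev_injective_iff, injective_iff_map_eq_zero]
  intro f
  refine LaurentPolynomial.induction_on_mul_T (motive := fun f => evAlg _ c f = 0 → f = 0) f ?_
  intro p n h
  rw [map_mul, evAlg_toLaurent, evAlg_T, mul_eq_zero] at h
  rcases h with h | h
  · by_cases hp : p = 0
    · rw [hp, map_zero, zero_mul]
    · exact (hc ⟨p, hp, h⟩).elim
  · exact (zpow_ne_zero _ c.ne_zero h).elim

/-- PC(C) ⟹ transcendence: if `c` is algebraic, its minimal polynomial is a non-zero formal
period with value `0`. -/
theorem transcendental_of_pc {c : ℂˣ}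
    (h : Function.Injective (evRingHom (G := ℤ) (AddMonoidHom.id ℤ) c)) :
    Transcendental ℚ (c : ℂ) := by
  rw [ev_injective_iff] at h
  rintro ⟨p, hp, hpc⟩
  apply hp
  have : Polynomial.toLaurent p = 0 := h (by rw [evAlg_toLaurent, hpc, map_zero])
  exact Polynomial.toLaurent_eq_zero.1 this

/-- The Period Conjecture for `(C, c)` is EQUIVALENT to the transcendence of `c`. -/
theorem pc_localised_iff (c : ℂˣ) :
    Function.Injective (evRingHom (G := ℤ) (AddMonoidHom.id ℤ) c) ↔ Transcendental ℚ (c : ℂ) :=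
  ⟨transcendental_of_pc, pc_localised⟩

/-- The comparison constant of the model: `2πi ∈ ℂˣ`. -/
def twoPiI : ℂˣ := Units.mk0 (2 * Real.pi * Complex.I) (by simp [Real.pi_ne_zero])

/-- PC(C) HOLDS for the comparison "multiplication by `(2πi)ⁿ` in weight `n`" (Lindemann 1882). -/
theorem pc_localised_twoPiI :
    Function.Injective (evRingHom (G := ℤ) (AddMonoidHom.id ℤ) twoPiI) :=
  pc_localised Literature.NumberTheory.Transcendental.transcendental_two_pi_I

/-! ### Proposition VI -/

/-- **Proposition VI** (KERNEL).  In the abstract period formalism of [HW22, Ch. 7]: for the tensor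
functor `F = wt_* : C^eff = 𝒞_E → C = 𝒞_ℤ` with compatible fibre functors (comparison `(2πi)^{wt}`),
(i) the Period Conjecture holds for `C`; (ii) it fails for `C^eff` (for every comparison constant);
(iii) `per` is a zero divisor of `P̃(C^eff)` and `P̃(F)` is not injective, with kernel `ℚ·(p_𝟙 − p_U)`,
while `P̃(F)(per)` is a unit; (iv) `F` is faithful and not full. -/
theorem soloInformed_propositionVI :
    Function.Injective (evRingHom (G := ℤ) (AddMonoidHom.id ℤ) twoPiI) ∧
    (∀ c : ℂˣ, ¬ Function.Injective (evRingHom (G := E) wt c)) ∧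
    (per ≠ 0 ∧ phantom ≠ 0 ∧ per * phantom = 0) ∧
    (¬ Function.Injective (fpMap (G := E) wt) ∧ (∀ y, fpMap wt y = 0 ↔ ∃ r : ℚ, y = r • phantom) ∧
      IsUnit (fpMap wt per)) ∧
    ((∀ X Y : SoloInformedGrObj E, Function.Injective (mapHom wt (X := X) (Y := Y))) ∧
      ¬ Function.Surjective (mapHom wt (X := unitObj) (Y := uObj))) :=
  ⟨pc_localised_twoPiI, not_pc_effective, ⟨per_ne_zero, phantom_ne_zero, per_mul_phantom⟩,
    ⟨not_injective_fpMap, ker_fpMap, isUnit_fpMap_per⟩, ⟨F_faithful, F_not_full⟩⟩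

end SoloInformedEffModel

end Summit.KontsevichZagierPeriods.KontsevichZagierPeriods.Theorems
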